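import Summits.CriticalPhenomena.PercolationContinuityZ3.Theorems.PercNearOneGluingNoHeavyRsw3VolumeBallFamily
import Summits.CriticalPhenomena.PercolationContinuityZ3.Theorems.PercNearOneGluingNoHeavyRsw3VolumeNearestNeighbour
import Summits.CriticalPhenomena.PercolationContinuityZ3.Theorems.PercNearOneGluingNoHeavyRsw3VolumeThreeBall
import HarnessLib

/-!
# RSW3 lane (P2, gen 21): KESTEN'S THEOREM (8) IN ALL MOMENTS, IV-b — from weights to probabilities: `P_p(⋂_i {0 ↔ q_i}) ≤ W(S(q))`
# and, with the exterior arm, `P_p(⋂_i {0 ↔ q_i} ∩ {0 ↔ ∂ⁱⁿΛ(M)}) ≤ W(S(q)) · P_p(Λ(2n+1) ↔ ∂ⁱⁿΛ(M))` (every `p`)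

builds on p205010 (kernel theorem, internal audit signed; external expert review pending) — NOT used in this file.

Cell `prim-rsw3`, prover seat `prim-rsw3-p2` (gen 21), memo `run/shared/lean/prim/rsw3/P2-RSWLITE.md` §28.
Support file (`--supports stmt-CriticalPhenomena-4575`); no definitions, no named facts, no sorries.

Notation of the docstrings: `π(k) = π_p(k)`, `s(n) = n^d π(n)`, `δ⟦S,x⟧` the nearest-neighbour distance (written inline),
`W(S) = ∏_{x ∈ S} π(⌊(δ⟦S,x⟧−1)/2⌋)`, and for a tuple `q : Fin t → Λ(n)`, `S(q) = {0} ∪ range q`.  Hypotheses (R1), (R_lin), (R2),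
`π(1) > 0`, `p > 0` as in parts III–IV-a.

* §4 `real_iInter_openConn_le_weight` — by part I with the nearest-neighbour radii: `P_p(⋂_i {0 ↔ q_i}) ≤ W(S(q))` (every `p`), and with
  the exterior arm `P_p(⋂_i {0 ↔ q_i} ∩ {0 ↔ ∂ⁱⁿΛ(M)}) ≤ W(S(q)) · P_p(Λ(2n+1) ↔ ∂ⁱⁿΛ(M))` (`M ≥ 2n+1`);
* the summed forms (`Σ_q P_p(⋂_i {0 ↔ q_i}) ≤ C_t s(n)^{t+1} π(n)`, with and without the arm) are assembled in part V.

References: H. Kesten, Probab. Theory Relat. Fields 73 (1986) 369–394, Thm. (8), (41)–(46) [Kesten1986]; C. Borgs, J. Chayes,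
H. Kesten, J. Spencer, Random Structures Algorithms 15 (1999), §1 [BorgsChayesKestenSpencer1999]. [folklore]
-/

noncomputable section

namespace Summit.CriticalPhenomena.PercolationContinuityZ3.Theorems

namespace Rsw3

open MeasureTheory Literature.Probability.LatticeModels Literature.Probability.Percolation
open SurfaceTension Crossing SimpleGraph Finset

variable {d : ℕ}

/-! ## §4 From weights to probabilities: part I with the nearest-neighbour radii -/

/-- **`P_p(⋂_i {0 ↔ q_i}) ≤ W(S(q))`** (every `p`, `d ≥ 1`): the finite-family ball bound of part I with the nearest-neighbour radii
`⌊(δ⟦S(q),x⟧−1)/2⌋` (pairwise separated by `nnd_radii_add_lt`); for `S(q) = {0}` both sides are `≤ 1 = W({0})`.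
[cite: Kesten1986, Thm. (8), (44)–(45)] -/
theorem real_iInter_openConn_le_weight (hd : 1 ≤ d) (p : unitInterval) {t : ℕ} (q : Fin t → Site d) :
    (bondPercolation (zdGraph d) p).real (⋂ i, (openConn (0 : Site d) (q i) : Set (BondConfig (Site d)))) ≤
      ∏ x ∈ insert (0 : Site d) (Finset.univ.image q),
        oneArmProb d p ((((Finset.erase (insert (0 : Site d) (Finset.univ.image q)) x).inf
          (fun w => ((Site.supNorm (x - w) : ℕ) : ℕ∞))).toNat - 1) / 2) := by
  classical
  rw [iInter_openConn_eq_biInter]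
  set S := insert (0 : Site d) (Finset.univ.image q) with hSdef
  have h0 : (0 : Site d) ∈ S := Finset.mem_insert_self _ _
  by_cases hS : ∃ y ∈ S, y ≠ 0
  · exact real_biInter_openConn_le_prod p (r := fun x => (((Finset.erase S x).inf
      (fun w => ((Site.supNorm (x - w) : ℕ) : ℕ∞))).toNat - 1) / 2) h0 hS fun x hx y hy hxy => nnd_radii_add_lt hx hy hxy
  · push Not at hS
    have hS0 : S = {0} := Finset.eq_singleton_iff_unique_mem.2 ⟨h0, hS⟩
    rw [hS0, Finset.prod_singleton, nnd_singleton, oneArmProb_zero hd p]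
    exact measureReal_le_one

/-- `{0 ↔ ∂ⁱⁿΛ(M)} ⊆ {Λ(R) ↔ ∂ⁱⁿΛ(M) in Λ(M)}` in probability (`R ≤ M`; `0 ∈ Λ(R)`). [folklore] -/
theorem oneArmProb_le_real_boxCrossing (p : unitInterval) {R M : ℕ} (hRM : R ≤ M) :
    oneArmProb d p M ≤ (bondPercolation (zdGraph d) p).real (boxCrossing d R M) := by
  refine DCT16.real_mono_of_forall_subset_edgeSet (zdGraph d) p fun ω hω h => ?_
  rw [DCT16.mem_siteToBoundary_iff] at h
  obtain ⟨y, hy, hpath⟩ := h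
  exact (mem_cross_iff_mem_boxCrossing hRM hω).1 ⟨0, zero_mem_box d R, y, hy, DCT16.mem_openConnIn_of_pathIn hpath⟩

/-- **With the exterior arm: `P_p(⋂_i {0 ↔ q_i} ∩ {0 ↔ ∂ⁱⁿΛ(M)}) ≤ W(S(q)) · P_p(Λ(2n+1) ↔ ∂ⁱⁿΛ(M) in Λ(M))`** for
`q : Fin t → Λ(n)` and `M ≥ 2n + 1` (every `p`, `d ≥ 1`): the nearest-neighbour balls of `S(q) ⊆ Λ(n)` lie in `Λ(2n)`
(`supNorm_add_nnd_radius_le`), and part I applies with `R = 2n + 1`. [cite: Kesten1986, Thm. (8), (41)–(45)] -/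
theorem real_iInter_openConn_inter_siteToBoundary_le_weight_mul (hd : 1 ≤ d) (p : unitInterval) {t n M : ℕ}
    {q : Fin t → Site d} (hq : q ∈ Fintype.piFinset (fun _ : Fin t => box d n)) (hM : 2 * n + 1 ≤ M) :
    (bondPercolation (zdGraph d) p).real
        ((⋂ i, (openConn (0 : Site d) (q i) : Set (BondConfig (Site d)))) ∩ siteToBoundary d M) ≤
      (∏ x ∈ insert (0 : Site d) (Finset.univ.image q),
        oneArmProb d p ((((Finset.erase (insert (0 : Site d) (Finset.univ.image q)) x).inf
          (fun w => ((Site.supNorm (x - w) : ℕ) : ℕ∞))).toNat - 1) / 2)) *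
        (bondPercolation (zdGraph d) p).real (boxCrossing d (2 * n + 1) M) := by
  classical
  rw [iInter_openConn_eq_biInter]
  have hSn := insert_image_subset_box hq
  set S := insert (0 : Site d) (Finset.univ.image q) with hSdef
  have h0 : (0 : Site d) ∈ S := Finset.mem_insert_self _ _
  have hSn' : ∀ y ∈ S, Site.supNorm y ≤ n := fun y hy => mem_box_iff_supNorm_le.1 (hSn hy)
  by_cases hS : ∃ y ∈ S, y ≠ 0
  · exact real_biInter_openConn_inter_siteToBoundary_le_prod_mul p (r := fun x => (((Finset.erase S x).inf
      (fun w => ((Site.supNorm (x - w) : ℕ) : ℕ∞))).toNat - 1) / 2) h0 hS (fun x hx y hy hxy => nnd_radii_add_lt hx hy hxy)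
      (by omega) hM fun x hx => supNorm_add_nnd_radius_le hSn' h0 hS hx
  · push Not at hS
    have hS0 : S = {0} := Finset.eq_singleton_iff_unique_mem.2 ⟨h0, hS⟩
    rw [hS0, Finset.prod_singleton, nnd_singleton, oneArmProb_zero hd p, one_mul]
    calc (bondPercolation (zdGraph d) p).real
          ((⋂ x ∈ ({0} : Finset (Site d)), (openConn (0 : Site d) x : Set (BondConfig (Site d)))) ∩ siteToBoundary d M)
        ≤ (bondPercolation (zdGraph d) p).real (siteToBoundary d M) := measureReal_mono Set.inter_subset_right
      _ ≤ (bondPercolation (zdGraph d) p).real (boxCrossing d (2 * n + 1) M) := oneArmProb_le_real_boxCrossing p hM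

end Rsw3

end Summit.CriticalPhenomena.PercolationContinuityZ3.Theorems
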